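import Literature.Analysis.SingularIntegrals.Marcinkiewicz
import Literature.Analysis.FluidPDE.ParabolicMaximalFunction
import HarnessLib

/-!
# The maximal function on parabolic cylinders: strong type `(p,p)`, `1 < p`
(Lemarié-Rieusset 2016, Lemma 5.2, second item)

Analysis/FluidPDE proofs file in the decomposition of the named fact
`Literature.Analysis.FluidPDE.adams_parabolicRieszPotential` (Cor. 5.1, p. 112), second layer
over `ParabolicMaximalFunction.lean` (the maximal function `𝓜F` on the cylinders `Q_r(t,x)` of
`ℝ × ℝ³` and its weak type `(1,1)`): the **strong type `(p,p)`** for `1 < p < ∞`,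
`∫∫ (𝓜F)^p ≤ C_p ∫∫ F^p` (Lemma 5.2, second item: "for `1 < p ≤ ∞` and for every `f ∈ L^p`,
`‖𝓜_f‖_p ≤ C_p ‖f‖_p`", there "a direct consequence of the Marcinkiewicz interpolation
theorem"). Mathlib has no Marcinkiewicz theorem; the proof here is the classical direct one:
for a level `λ` split `F ≤ F 1_{F > λ/2} + λ/2`, so that `{𝓜F > λ} ⊆ {𝓜(F 1_{F>λ/2}) > λ/2}` and,
by the weak type `(1,1)`, `|{𝓜F > λ}| ≤ 2·5⁵ λ⁻¹ ∫∫_{F > λ/2} F`; then the layer-cake formula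
(`MeasureTheory.lintegral_rpow_eq_lintegral_meas_lt_mul`, applied to the truncations
`min(𝓜F, N)`), Tonelli, and the elementary integral `∫₀^a t^{p-2} dt = a^{p-1}/(p-1)` of the
accepted `SingularIntegrals/Marcinkiewicz.lean` give
`∫∫ (𝓜F)^p ≤ 2·5⁵ p ∫∫ F (∫₀^{2F} t^{p-2} dt) = 2^p 5⁵ (p/(p-1)) ∫∫ F^p`.

* `parabolicMaximalFunction_add_le`, `parabolicMaximalFunction_const_le` — subadditivity,
  constants;
* `volume_setOf_lt_parabolicMaximalFunction_le_setLIntegral` — the weak-type bound with the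
  truncated right-hand side `2·5⁵ λ⁻¹ ∫∫_{F > λ/2} F`;
* `lintegral_parabolicMaximalFunction_rpow_le` — the strong type `(p,p)` with the explicit
  constant `C_p = p · 2·5⁵ · 2^{p-1}/(p-1) < ∞` (`parabolicMaximalLpConst_lt_top`), for
  a.e.-measurable sizes.

## References

* P. G. Lemarié-Rieusset, *The Navier–Stokes Problem in the 21st Century*, CRC Press (2016),
  Lemma 5.2 (pp. 110–111). [LemarieRieusset2016]
* E. M. Stein, *Singular Integrals and Differentiability Properties of Functions* (1970), Ch. I
  §1, Thm. 1 (the maximal theorem, whose proof is followed here).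
-/

noncomputable section

open MeasureTheory Set Filter Topology Metric
open scoped NNReal ENNReal

namespace Literature.Analysis.FluidPDE

/-- Local notation for physical space `ℝ³ = EuclideanSpace ℝ (Fin 3)`. -/
local notation "ℝ³" => EuclideanSpace ℝ (Fin 3)

/-! ### Subadditivity -/

/-- The maximal function is subadditive in the size (first summand a.e.-measurable). [folklore] -/
theorem parabolicMaximalFunction_add_le {F G : ℝ × ℝ³ → ℝ≥0∞} (hF : AEMeasurable F)
    (z : ℝ × ℝ³) :
    parabolicMaximalFunction (fun w => F w + G w) z ≤
      parabolicMaximalFunction F z + parabolicMaximalFunction G z := by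
  refine iSup₂_le fun r hr => ?_
  rw [lintegral_add_left' hF.restrict, mul_add]
  exact add_le_add (average_le_parabolicMaximalFunction F z hr)
    (average_le_parabolicMaximalFunction G z hr)

/-- The maximal function of a constant is at most that constant. [folklore] -/
theorem parabolicMaximalFunction_const_le (c : ℝ≥0∞) (z : ℝ × ℝ³) :
    parabolicMaximalFunction (fun _ => c) z ≤ c := by
  refine iSup₂_le fun r hr => ?_
  have hV0 := (volume_parabolicCylinderCentered_pos hr z).ne'
  have hVt := (volume_parabolicCylinderCentered_lt_top r z).ne
  rw [setLIntegral_const]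
  have h : (volume (FluidPDE.parabolicCylinderCentered r z))⁻¹ *
        (c * volume (FluidPDE.parabolicCylinderCentered r z)) = c := by
    calc (volume (FluidPDE.parabolicCylinderCentered r z))⁻¹ *
          (c * volume (FluidPDE.parabolicCylinderCentered r z))
        = c * ((volume (FluidPDE.parabolicCylinderCentered r z))⁻¹ *
            volume (FluidPDE.parabolicCylinderCentered r z)) := by ring
      _ = c := by rw [ENNReal.inv_mul_cancel hV0 hVt, mul_one]
  exact h.le

/-! ### The weak-type bound with truncated right-hand side -/

/-- **`|{𝓜F > λ}| ≤ 2·5⁵ λ⁻¹ ∫∫_{F > λ/2} F`** for measurable `F` and `0 < λ < ∞`: split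
`F ≤ F 1_{F > λ/2} + λ/2`, so that `𝓜F ≤ 𝓜(F 1_{F > λ/2}) + λ/2` and
`{𝓜F > λ} ⊆ {𝓜(F 1_{F>λ/2}) > λ/2}`, and apply the weak type `(1,1)`. [folklore] -/
theorem volume_setOf_lt_parabolicMaximalFunction_le_setLIntegral {F : ℝ × ℝ³ → ℝ≥0∞}
    (hF : Measurable F) {l : ℝ≥0∞} (hl : l ≠ 0) (hlt : l ≠ ∞) :
    volume {z | l < parabolicMaximalFunction F z} ≤
      2 * 5 ^ 5 * l⁻¹ * ∫⁻ w in {w | l / 2 < F w}, F w := by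
  have hS : MeasurableSet {w | l / 2 < F w} := measurableSet_lt measurable_const hF
  have hl2 : l / 2 ≠ 0 := (ENNReal.div_pos_iff.2 ⟨hl, ENNReal.ofNat_ne_top⟩).ne'
  have hl2t : l / 2 ≠ ∞ := ENNReal.div_ne_top hlt two_ne_zero
  -- domination `F ≤ F 1_{F > λ/2} + λ/2`
  have hdom : ∀ w, F w ≤ {w | l / 2 < F w}.indicator F w + l / 2 := fun w => by
    by_cases hw : l / 2 < F w
    · rw [indicator_of_mem (show w ∈ {w | l / 2 < F w} from hw)]
      exact le_self_add
    · rw [indicator_of_notMem (show w ∉ {w | l / 2 < F w} from hw), zero_add]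
      exact not_lt.1 hw
  have hsub : {z | l < parabolicMaximalFunction F z} ⊆
      {z | l / 2 < parabolicMaximalFunction ({w | l / 2 < F w}.indicator F) z} := by
    intro z hz
    have hM1 : parabolicMaximalFunction F z ≤
        parabolicMaximalFunction (fun w => {w | l / 2 < F w}.indicator F w + l / 2) z :=
      parabolicMaximalFunction_mono hdom z
    have hM2 : parabolicMaximalFunction (fun w => {w | l / 2 < F w}.indicator F w + l / 2) z ≤
        parabolicMaximalFunction ({w | l / 2 < F w}.indicator F) z +
          parabolicMaximalFunction (fun _ => l / 2) z :=
      parabolicMaximalFunction_add_le (G := fun _ => l / 2) (hF.indicator hS).aemeasurable z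
    have hM3 : parabolicMaximalFunction (fun _ : ℝ × ℝ³ => l / 2) z ≤ l / 2 :=
      parabolicMaximalFunction_const_le _ z
    have hM : parabolicMaximalFunction F z ≤
        parabolicMaximalFunction ({w | l / 2 < F w}.indicator F) z + l / 2 :=
      hM1.trans (hM2.trans (add_le_add le_rfl hM3))
    have h2 : l / 2 + l / 2 <
        parabolicMaximalFunction ({w | l / 2 < F w}.indicator F) z + l / 2 := by
      rw [ENNReal.add_halves]
      exact lt_of_lt_of_le hz hM
    exact (ENNReal.add_lt_add_iff_right hl2t).1 h2
  calc volume {z | l < parabolicMaximalFunction F z}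
      ≤ volume {z | l / 2 < parabolicMaximalFunction ({w | l / 2 < F w}.indicator F) z} :=
        measure_mono hsub
    _ ≤ 5 ^ 5 * (l / 2)⁻¹ * ∫⁻ w, {w | l / 2 < F w}.indicator F w :=
        volume_setOf_lt_parabolicMaximalFunction_le _ hl2
    _ = 2 * 5 ^ 5 * l⁻¹ * ∫⁻ w in {w | l / 2 < F w}, F w := by
        rw [lintegral_indicator hS, ENNReal.inv_div (Or.inr hlt) (Or.inr hl), div_eq_mul_inv,
          ← mul_assoc, mul_comm ((5 : ℝ≥0∞) ^ 5) 2]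

/-! ### The layer-cake computation -/

/-- The inner integral of the layer-cake computation:
`∫_{t > 0} 1_{t < b} t^{p-2} dt ≤ b^{p-1}/(p-1)` (`p > 1`, `b ∈ [0, ∞]`; equality for `b < ∞`). [folklore] -/
theorem lintegral_Ioi_indicator_rpow_le {p : ℝ} (hp : 1 < p) (b : ℝ≥0∞) :
    ∫⁻ t in Ioi (0 : ℝ), {t : ℝ | ENNReal.ofReal t < b}.indicator
        (fun t => ENNReal.ofReal (t ^ (p - 2))) t ≤
      b ^ (p - 1) / ENNReal.ofReal (p - 1) := by
  have hp1 : 0 < p - 1 := by linarith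
  rcases eq_or_ne b ∞ with rfl | hb
  · rw [ENNReal.top_rpow_of_pos hp1, ENNReal.top_div_of_ne_top ENNReal.ofReal_ne_top]
    exact le_top
  have hmeas : MeasurableSet {t : ℝ | ENNReal.ofReal t < b} :=
    measurableSet_lt ENNReal.measurable_ofReal measurable_const
  rw [lintegral_indicator hmeas, Measure.restrict_restrict hmeas]
  have hset : {t : ℝ | ENNReal.ofReal t < b} ∩ Ioi 0 = Ioo 0 b.toReal := by
    ext t
    simp only [mem_inter_iff, mem_setOf_eq, mem_Ioi, mem_Ioo]
    constructor
    · rintro ⟨h1, h2⟩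
      exact ⟨h2, (ENNReal.ofReal_lt_iff_lt_toReal h2.le hb).1 h1⟩
    · rintro ⟨h1, h2⟩
      exact ⟨(ENNReal.ofReal_lt_iff_lt_toReal h1.le hb).2 h2, h1⟩
  rw [hset, SingularIntegrals.lintegral_Ioo_rpow_sub_two hp ENNReal.toReal_nonneg,
    ENNReal.ofReal_div_of_pos hp1, ← ENNReal.ofReal_rpow_of_nonneg ENNReal.toReal_nonneg hp1.le,
    ENNReal.ofReal_toReal hb]

/-- **The constant of the maximal theorem** `C_p = p · 2·5⁵ · 2^{p-1}/(p-1)` is finite for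
`p > 1` (any finite constant would do downstream). [folklore] -/
theorem parabolicMaximalLpConst_lt_top {p : ℝ} (hp : 1 < p) :
    ENNReal.ofReal p * (2 * 5 ^ 5) * ((2 : ℝ≥0∞) ^ (p - 1) / ENNReal.ofReal (p - 1)) < ∞ := by
  have h1 : (2 : ℝ≥0∞) ^ (p - 1) / ENNReal.ofReal (p - 1) < ∞ :=
    ENNReal.div_lt_top (ENNReal.rpow_ne_top_of_nonneg (by linarith) ENNReal.ofNat_ne_top)
      ((ENNReal.ofReal_pos.2 (by linarith)).ne')
  exact ENNReal.mul_lt_top (ENNReal.mul_lt_top ENNReal.ofReal_lt_top (by norm_num)) h1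

/-- `sup_N min(a, N)^p = a^p` in `[0, ∞]` (`p > 0`). [folklore] -/
theorem iSup_min_natCast_rpow {p : ℝ} (hp : 0 < p) (a : ℝ≥0∞) :
    (⨆ N : ℕ, min a N ^ p) = a ^ p := by
  apply le_antisymm (iSup_le fun N => ENNReal.rpow_le_rpow (min_le_left _ _) hp.le)
  rcases eq_or_ne a ∞ with rfl | ha
  · rw [ENNReal.top_rpow_of_pos hp]
    simp only [min_eq_right le_top]
    rcases le_or_gt 1 p with hp1 | hp1
    · calc (⊤ : ℝ≥0∞) = ⨆ n : ℕ, (n : ℝ≥0∞) := ENNReal.iSup_natCast.symm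
        _ ≤ ⨆ N : ℕ, (N : ℝ≥0∞) ^ p := iSup_mono fun N => by
            rcases Nat.eq_zero_or_pos N with rfl | hN
            · simp [ENNReal.zero_rpow_of_pos hp]
            · exact ENNReal.le_rpow_self_of_one_le (by exact_mod_cast hN) hp1
    · -- `p < 1`: `N^p ≥ N^p` with `N^p → ∞` as well (`(N^p) ≥ (N)^p`, and `⨆ N = ⊤`)
      refine top_le_iff.2 (ENNReal.eq_top_of_forall_nnreal_le fun c => ?_)
      obtain ⟨N, hN⟩ := exists_nat_gt ((c : ℝ) ^ (1 / p))
      refine le_iSup_of_le N ?_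
      have hc0 : (0 : ℝ) ≤ (c : ℝ) ^ (1 / p) := Real.rpow_nonneg (NNReal.coe_nonneg c) _
      have h1 : ((c : ℝ) ^ (1 / p)) ^ p ≤ (N : ℝ) ^ p :=
        Real.rpow_le_rpow hc0 hN.le hp.le
      rw [← Real.rpow_mul (NNReal.coe_nonneg c), one_div_mul_cancel hp.ne', Real.rpow_one] at h1
      calc (c : ℝ≥0∞) = ENNReal.ofReal (c : ℝ) := by rw [ENNReal.ofReal_coe_nnreal]
        _ ≤ ENNReal.ofReal ((N : ℝ) ^ p) := ENNReal.ofReal_le_ofReal h1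
        _ = (N : ℝ≥0∞) ^ p := by
            rw [← ENNReal.ofReal_rpow_of_nonneg (Nat.cast_nonneg N) hp.le, ENNReal.ofReal_natCast]
  · obtain ⟨N, hN⟩ := exists_nat_gt a.toReal
    have hle : a ≤ N := by
      rw [← ENNReal.ofReal_toReal ha, ← ENNReal.ofReal_natCast]
      exact ENNReal.ofReal_le_ofReal hN.le
    exact le_iSup_of_le N (by rw [min_eq_left hle])

/-- **Strong type `(p,p)` for measurable sizes** (the core of Lemma 5.2, second item):
`∫∫ (𝓜F)^p ≤ C_p ∫∫ F^p`, `1 < p`. Layer cake on the truncations `min(𝓜F, N)`, the weak-type bound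
with truncated right-hand side, Tonelli, and `N → ∞` by monotone convergence. [cite: LemarieRieusset2016, Lemma 5.2 p. 110] -/
theorem lintegral_parabolicMaximalFunction_rpow_le_of_measurable {F : ℝ × ℝ³ → ℝ≥0∞}
    (hF : Measurable F) {p : ℝ} (hp : 1 < p) :
    ∫⁻ z, parabolicMaximalFunction F z ^ p ≤
      (ENNReal.ofReal p * (2 * 5 ^ 5) * ((2 : ℝ≥0∞) ^ (p - 1) / ENNReal.ofReal (p - 1))) *
        ∫⁻ w, F w ^ p := by
  have hp0 : 0 < p := by linarith
  have hp1 : 0 < p - 1 := by linarith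
  set M := parabolicMaximalFunction F with hM_def
  have hMm : Measurable M := measurable_parabolicMaximalFunction F
  -- Step 1: reduction to the truncations `min M N`
  suffices htrunc : ∀ N : ℕ, ∫⁻ z, min (M z) N ^ p ≤
      (ENNReal.ofReal p * (2 * 5 ^ 5) * ((2 : ℝ≥0∞) ^ (p - 1) / ENNReal.ofReal (p - 1))) * ∫⁻ w, F w ^ p by
    have hmono : Monotone fun (N : ℕ) (z : ℝ × ℝ³) => min (M z) N ^ p := by
      intro a b hab z
      exact ENNReal.rpow_le_rpow (min_le_min le_rfl (Nat.cast_le.2 hab)) hp0.le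
    calc ∫⁻ z, M z ^ p = ∫⁻ z, ⨆ N : ℕ, min (M z) N ^ p := by
          simp_rw [iSup_min_natCast_rpow hp0]
      _ = ⨆ N : ℕ, ∫⁻ z, min (M z) N ^ p :=
          lintegral_iSup (fun N => (hMm.min measurable_const).pow_const p) hmono
      _ ≤ _ := iSup_le htrunc
  intro N
  -- Step 2: layer cake for the real-valued truncation `g = min(M, N)`
  have hmin_ne : ∀ z, min (M z) N ≠ ∞ := fun z =>
    ((min_le_right _ _).trans_lt (ENNReal.natCast_lt_top N)).ne
  set g : ℝ × ℝ³ → ℝ := fun z => (min (M z) N).toReal with hg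
  have hg_nn : 0 ≤ᵐ[volume] g := Eventually.of_forall fun z => ENNReal.toReal_nonneg
  have hg_m : AEMeasurable g := (hMm.min measurable_const).ennreal_toReal.aemeasurable
  have hlhs : ∫⁻ z, min (M z) N ^ p = ∫⁻ z, ENNReal.ofReal (g z ^ p) := by
    refine lintegral_congr fun z => ?_
    simp only [hg]
    rw [← ENNReal.ofReal_rpow_of_nonneg ENNReal.toReal_nonneg hp0.le,
      ENNReal.ofReal_toReal (hmin_ne z)]
  rw [hlhs, lintegral_rpow_eq_lintegral_meas_lt_mul volume hg_nn hg_m hp0]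
  -- Step 3: the level sets of `g` are level sets of `M`, bounded by the weak type
  have hlev : ∀ t : ℝ, 0 < t → volume {z | t < g z} ≤
      2 * 5 ^ 5 * (ENNReal.ofReal t)⁻¹ * ∫⁻ w in {w | ENNReal.ofReal t / 2 < F w}, F w := by
    intro t ht
    have hsub : {z | t < g z} ⊆ {z | ENNReal.ofReal t < M z} := fun z hz => by
      have h1 : ENNReal.ofReal t < min (M z) N :=
        (ENNReal.ofReal_lt_iff_lt_toReal ht.le (hmin_ne z)).2 hz
      exact h1.trans_le (min_le_left _ _)
    exact (measure_mono hsub).trans (volume_setOf_lt_parabolicMaximalFunction_le_setLIntegral hF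
      (ENNReal.ofReal_pos.2 ht).ne' ENNReal.ofReal_ne_top)
  -- Step 4: the joint integrand for Tonelli
  set T : Set (ℝ × (ℝ × ℝ³)) := {q | ENNReal.ofReal q.1 / 2 < F q.2} with hT
  have hTm : MeasurableSet T :=
    measurableSet_lt ((ENNReal.measurable_ofReal.comp measurable_fst).div_const 2)
      (hF.comp measurable_snd)
  set Φ : ℝ × (ℝ × ℝ³) → ℝ≥0∞ :=
    T.indicator fun q => F q.2 * ENNReal.ofReal (q.1 ^ (p - 2)) with hΦ
  have hΦm : Measurable Φ :=
    ((hF.comp measurable_snd).mul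
      (ENNReal.measurable_ofReal.comp ((measurable_fst.pow_const (p - 2))))).indicator hTm
  -- the `t`-sections of `Φ`
  have hΦt : ∀ t : ℝ, 0 < t → (2 * 5 ^ 5 * (ENNReal.ofReal t)⁻¹ *
      ∫⁻ w in {w | ENNReal.ofReal t / 2 < F w}, F w) * ENNReal.ofReal (t ^ (p - 1)) =
      2 * 5 ^ 5 * ∫⁻ w, Φ (t, w) := by
    intro t ht
    have hSt : MeasurableSet {w | ENNReal.ofReal t / 2 < F w} :=
      measurableSet_lt measurable_const hF
    have hsec : ∀ w, Φ (t, w) =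
        {w | ENNReal.ofReal t / 2 < F w}.indicator F w * ENNReal.ofReal (t ^ (p - 2)) := by
      intro w
      by_cases hw : ENNReal.ofReal t / 2 < F w
      · rw [hΦ, indicator_of_mem (show (t, w) ∈ T from hw),
          indicator_of_mem (show w ∈ {w | ENNReal.ofReal t / 2 < F w} from hw)]
      · rw [hΦ, indicator_of_notMem (show (t, w) ∉ T from hw),
          indicator_of_notMem (show w ∉ {w | ENNReal.ofReal t / 2 < F w} from hw), zero_mul]
    have hpow : (ENNReal.ofReal t)⁻¹ * ENNReal.ofReal (t ^ (p - 1)) =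
        ENNReal.ofReal (t ^ (p - 2)) := by
      have : t ^ (p - 1) = t * t ^ (p - 2) := by
        rw [← Real.rpow_one_add' ht.le (by linarith)]
        ring_nf
      rw [this, ENNReal.ofReal_mul ht.le, ← mul_assoc,
        ENNReal.inv_mul_cancel (ENNReal.ofReal_pos.2 ht).ne' ENNReal.ofReal_ne_top, one_mul]
    simp_rw [hsec]
    rw [lintegral_mul_const _ ((hF.indicator hSt)), lintegral_indicator hSt, ← hpow]
    ring
  -- the `w`-sections of `Φ`
  have hΦw : ∀ w, ∫⁻ t in Ioi 0, Φ (t, w) ≤ F w * ((F w * 2) ^ (p - 1) / ENNReal.ofReal (p - 1)) := by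
    intro w
    have hsec : ∀ t, Φ (t, w) = F w * {t : ℝ | ENNReal.ofReal t < F w * 2}.indicator
        (fun t => ENNReal.ofReal (t ^ (p - 2))) t := by
      intro t
      have hiff : ENNReal.ofReal t / 2 < F w ↔ ENNReal.ofReal t < F w * 2 :=
        ENNReal.div_lt_iff (Or.inl two_ne_zero) (Or.inl ENNReal.ofNat_ne_top)
      by_cases ht : ENNReal.ofReal t / 2 < F w
      · rw [hΦ, indicator_of_mem (show (t, w) ∈ T from ht),
          indicator_of_mem (show t ∈ {t : ℝ | ENNReal.ofReal t < F w * 2} from hiff.1 ht)]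
      · rw [hΦ, indicator_of_notMem (show (t, w) ∉ T from ht),
          indicator_of_notMem (show t ∉ {t : ℝ | ENNReal.ofReal t < F w * 2} from
            fun h => ht (hiff.2 h)), mul_zero]
    simp_rw [hsec]
    have hm : Measurable fun t : ℝ => ENNReal.ofReal (t ^ (p - 2)) :=
      ENNReal.measurable_ofReal.comp (measurable_id.pow_const (p - 2))
    have hmt : MeasurableSet {t : ℝ | ENNReal.ofReal t < F w * 2} :=
      measurableSet_lt ENNReal.measurable_ofReal measurable_const
    rw [lintegral_const_mul _ (hm.indicator hmt)]
    exact mul_le_mul' le_rfl (lintegral_Ioi_indicator_rpow_le hp (F w * 2))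
  -- Step 5: the chain
  have h25 : (2 * 5 ^ 5 : ℝ≥0∞) ≠ ∞ := by norm_num
  calc ENNReal.ofReal p * ∫⁻ t in Ioi 0, volume {z | t < g z} * ENNReal.ofReal (t ^ (p - 1))
      ≤ ENNReal.ofReal p * ∫⁻ t in Ioi 0, (2 * 5 ^ 5 * (ENNReal.ofReal t)⁻¹ *
          ∫⁻ w in {w | ENNReal.ofReal t / 2 < F w}, F w) * ENNReal.ofReal (t ^ (p - 1)) := by
        refine mul_le_mul' le_rfl (setLIntegral_mono' measurableSet_Ioi fun t ht => ?_)
        exact mul_le_mul' (hlev t ht) le_rfl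
    _ = ENNReal.ofReal p * ∫⁻ t in Ioi 0, 2 * 5 ^ 5 * ∫⁻ w, Φ (t, w) :=
        congrArg _ (setLIntegral_congr_fun measurableSet_Ioi fun t ht => hΦt t ht)
    _ = ENNReal.ofReal p * (2 * 5 ^ 5 * ∫⁻ w, ∫⁻ t in Ioi 0, Φ (t, w)) := by
        rw [lintegral_const_mul' _ _ h25,
          lintegral_lintegral_swap (f := fun t w => Φ (t, w)) hΦm.aemeasurable]
    _ ≤ ENNReal.ofReal p * (2 * 5 ^ 5 *
          ∫⁻ w, F w * ((F w * 2) ^ (p - 1) / ENNReal.ofReal (p - 1))) :=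
        mul_le_mul' le_rfl (mul_le_mul' le_rfl (lintegral_mono hΦw))
    _ = (ENNReal.ofReal p * (2 * 5 ^ 5) * ((2 : ℝ≥0∞) ^ (p - 1) / ENNReal.ofReal (p - 1))) *
          ∫⁻ w, F w ^ p := by
        have hpt : ∀ w, F w * ((F w * 2) ^ (p - 1) / ENNReal.ofReal (p - 1)) =
            (2 : ℝ≥0∞) ^ (p - 1) / ENNReal.ofReal (p - 1) * F w ^ p := by
          intro w
          have hFp : F w * F w ^ (p - 1) = F w ^ p := by
            conv_lhs => rw [← ENNReal.rpow_one (F w)]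
            rw [← ENNReal.rpow_mul, one_mul, ← ENNReal.rpow_add_of_nonneg _ _ zero_le_one hp1.le]
            congr 1; ring
          rw [ENNReal.mul_rpow_of_nonneg _ _ hp1.le, div_eq_mul_inv, div_eq_mul_inv, ← hFp]
          ring
        simp_rw [hpt]
        rw [lintegral_const_mul _ (hF.pow_const p)]
        ring

/-- **Strong type `(p,p)` of the parabolic maximal function** (Lemarié-Rieusset 2016, Lemma 5.2,
second item: "`‖𝓜_f‖_p ≤ C_p ‖f‖_p`" for `1 < p`), for a.e.-measurable sizes on `ℝ × ℝ³`:
`∫∫ (𝓜F)^p ≤ C_p ∫∫ F^p` with `C_p = p · 2·5⁵ · 2^{p-1}/(p-1) < ∞`. [cite: LemarieRieusset2016, Lemma 5.2 p. 110] -/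
theorem lintegral_parabolicMaximalFunction_rpow_le {F : ℝ × ℝ³ → ℝ≥0∞} (hF : AEMeasurable F)
    {p : ℝ} (hp : 1 < p) :
    ∫⁻ z, parabolicMaximalFunction F z ^ p ≤
      (ENNReal.ofReal p * (2 * 5 ^ 5) * ((2 : ℝ≥0∞) ^ (p - 1) / ENNReal.ofReal (p - 1))) *
        ∫⁻ w, F w ^ p := by
  have h2 : ∫⁻ w, F w ^ p = ∫⁻ w, hF.mk F w ^ p :=
    lintegral_congr_ae (hF.ae_eq_mk.mono fun w hw => by dsimp only; rw [hw])
  rw [parabolicMaximalFunction_congr_ae hF.ae_eq_mk, h2]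
  exact lintegral_parabolicMaximalFunction_rpow_le_of_measurable hF.measurable_mk hp

end Literature.Analysis.FluidPDE
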